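import Mathlib
import HarnessLib

/-!
# `TypeIIToLevel` (route `LiouvilleMAD`), part 3a: class splitting on dyadic boxes

Support file for the item stmt-Parity-14996
(`Summit.Parity.GeneralizedHardyLittlewood.Theses.LiouvilleMAD.TypeIIToLevel`).

Input: a function `Φ : ℕ → ℝ` with `|Φ| ≤ 1` and a DYADIC bilinear bound with power saving (the shape of
the route node `TypeIILiouville`, where `Φ(k) = λ(k + c)`): for `1 ≤ N ≤ M` and real coefficients,
`|∑_{m ∈ (M,2M]} ∑_{n ∈ (N,2N]} α(m) β(n) Φ(mn)| ≤ C ‖α‖₂ ‖β‖₂ (MN)^{1/2} (N^{−1/2} + M^{−η})`.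

Output of this part: the same bound, with an extra factor `q`, for the CLASS weight
`1[k ≡ w (q)] Φ(k)` on one dyadic box — class splitting `1[mn ≡ w] Φ(mn) = ∑_{u,v mod q, uv ≡ w} 1[m≡u] 1[n≡v] Φ(mn)`
with Cauchy–Schwarz over the classes (`abs_box_class_le`), and both orientations (`abs_box_le`).
Part 3b (`LiouvilleMADTypeIIToLevelTypeIIRect`) assembles the rectangle hypothesis of the Vaughan engine.
-/

noncomputable section

open Finset Real

namespace Summit.Parity.GeneralizedHardyLittlewood.Theorems.TypeIIToLevel

/-! ### Class pieces of a coefficient sequence -/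

/-- The `ℓ²`-mass of the class pieces `α·1[· % q = u]` adds up to that of `α`. [folklore] -/
theorem sum_range_sum_sq_ite_mod_eq {q : ℕ} (hq : 0 < q) (s : Finset ℕ) (α : ℕ → ℝ) :
    ∑ u ∈ range q, ∑ m ∈ s, (if m % q = u then α m else 0) ^ 2 = ∑ m ∈ s, α m ^ 2 := by
  rw [sum_comm]
  refine sum_congr rfl fun m _ => ?_
  have h : ∀ u, (if m % q = u then α m else 0) ^ 2 = if m % q = u then α m ^ 2 else 0 := by
    intro u; split_ifs <;> simp
  simp_rw [h]
  rw [sum_ite_eq]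
  rw [if_pos (mem_range.2 (Nat.mod_lt m hq))]

/-- Cauchy–Schwarz over the classes: `∑_u ‖α 1[·≡u]‖₂ ≤ √q ‖α‖₂`. [folklore] -/
theorem sum_range_sqrt_sum_sq_ite_le {q : ℕ} (hq : 0 < q) (s : Finset ℕ) (α : ℕ → ℝ) :
    ∑ u ∈ range q, Real.sqrt (∑ m ∈ s, (if m % q = u then α m else 0) ^ 2) ≤
      Real.sqrt q * Real.sqrt (∑ m ∈ s, α m ^ 2) := by
  have h := Real.sum_sqrt_mul_sqrt_le (range q) (f := fun _ => (1 : ℝ))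
    (g := fun u => ∑ m ∈ s, (if m % q = u then α m else 0) ^ 2) (fun _ => zero_le_one)
    (fun _ => sum_nonneg fun _ _ => sq_nonneg _)
  simp only [Real.sqrt_one, one_mul, sum_const, card_range, nsmul_eq_mul, mul_one] at h
  rwa [sum_range_sum_sq_ite_mod_eq hq] at h

/-! ### One dyadic box: class splitting -/

/-- **Class splitting on a dyadic box** (long variable first): for `1 ≤ N ≤ M`,
`|∑_{m∈(M,2M]} ∑_{n∈(N,2N]} α(m) β(n) 1[mn ≡ w (q)] Φ(mn)| ≤ C q ‖α‖₂ ‖β‖₂ (MN)^{1/2}(N^{−1/2} + M^{−η})`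
from the dyadic bilinear bound for `Φ` (each of the `q²` class pairs `(u, v)` is a bilinear form with
coefficients `α 1[·≡u]`, `β 1[·≡v]`, on whose support `1[mn ≡ w] = 1[uv ≡ w]` is constant; then
Cauchy–Schwarz over `u` and over `v`). [folklore] -/
theorem abs_box_class_le {Φ : ℕ → ℝ} {η C : ℝ} (hC : 0 ≤ C)
    (hΦ : ∀ M N : ℕ, 1 ≤ N → N ≤ M → ∀ α β : ℕ → ℝ,
      |∑ m ∈ Ioc M (2 * M), ∑ n ∈ Ioc N (2 * N), α m * β n * Φ (m * n)| ≤
        C * Real.sqrt (∑ m ∈ Ioc M (2 * M), α m ^ 2) * Real.sqrt (∑ n ∈ Ioc N (2 * N), β n ^ 2) *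
          (Real.sqrt ((M : ℝ) * N) * ((N : ℝ) ^ (-(1 / 2 : ℝ)) + (M : ℝ) ^ (-η))))
    {q : ℕ} (hq : 0 < q) (w : ℕ) {M N : ℕ} (hN : 1 ≤ N) (hNM : N ≤ M) (α β : ℕ → ℝ) :
    |∑ m ∈ Ioc M (2 * M), ∑ n ∈ Ioc N (2 * N),
        α m * β n * (if m * n ≡ w [MOD q] then Φ (m * n) else 0)| ≤
      C * q * Real.sqrt (∑ m ∈ Ioc M (2 * M), α m ^ 2) * Real.sqrt (∑ n ∈ Ioc N (2 * N), β n ^ 2) *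
        (Real.sqrt ((M : ℝ) * N) * ((N : ℝ) ^ (-(1 / 2 : ℝ)) + (M : ℝ) ^ (-η))) := by
  set X : ℝ := Real.sqrt ((M : ℝ) * N) * ((N : ℝ) ^ (-(1 / 2 : ℝ)) + (M : ℝ) ^ (-η)) with hX
  have hX0 : 0 ≤ X := by positivity
  set sM := Ioc M (2 * M) with hsM
  set sN := Ioc N (2 * N) with hsN
  -- class pieces
  set αu : ℕ → ℕ → ℝ := fun u m => if m % q = u then α m else 0 with hαu
  set βv : ℕ → ℕ → ℝ := fun v n => if n % q = v then β n else 0 with hβv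
  have hα : ∀ m, α m = ∑ u ∈ range q, αu u m := by
    intro m; simp only [hαu]; rw [sum_ite_eq, if_pos (mem_range.2 (Nat.mod_lt m hq))]
  have hβ : ∀ n, β n = ∑ v ∈ range q, βv v n := by
    intro n; simp only [hβv]; rw [sum_ite_eq, if_pos (mem_range.2 (Nat.mod_lt n hq))]
  -- the indicator as a function of the classes
  set c : ℕ → ℕ → ℝ := fun m n => if m * n ≡ w [MOD q] then Φ (m * n) else 0 with hc
  -- Step 1: expand over the class pairs
  have hexp : ∑ m ∈ sM, ∑ n ∈ sN, α m * β n * c m n =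
      ∑ u ∈ range q, ∑ v ∈ range q, ∑ m ∈ sM, ∑ n ∈ sN, αu u m * βv v n * c m n := by
    have hterm : ∀ m n, α m * β n * c m n = ∑ u ∈ range q, ∑ v ∈ range q, αu u m * βv v n * c m n := by
      intro m n
      rw [hα m, hβ n, sum_mul_sum, sum_mul]
      refine sum_congr rfl fun u _ => ?_
      rw [sum_mul]
    simp_rw [hterm]
    -- now reorder `∑ m ∑ n ∑ u ∑ v` into `∑ u ∑ v ∑ m ∑ n`
    calc ∑ m ∈ sM, ∑ n ∈ sN, ∑ u ∈ range q, ∑ v ∈ range q, αu u m * βv v n * c m n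
        = ∑ m ∈ sM, ∑ u ∈ range q, ∑ n ∈ sN, ∑ v ∈ range q, αu u m * βv v n * c m n :=
          sum_congr rfl fun m _ => sum_comm
      _ = ∑ u ∈ range q, ∑ m ∈ sM, ∑ n ∈ sN, ∑ v ∈ range q, αu u m * βv v n * c m n := sum_comm
      _ = ∑ u ∈ range q, ∑ m ∈ sM, ∑ v ∈ range q, ∑ n ∈ sN, αu u m * βv v n * c m n :=
          sum_congr rfl fun u _ => sum_congr rfl fun m _ => sum_comm
      _ = ∑ u ∈ range q, ∑ v ∈ range q, ∑ m ∈ sM, ∑ n ∈ sN, αu u m * βv v n * c m n :=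
          sum_congr rfl fun u _ => sum_comm
  -- Step 2: on the support of `αu u · βv v` the indicator is the constant `1[uv ≡ w]`
  have hpair : ∀ u v, ∑ m ∈ sM, ∑ n ∈ sN, αu u m * βv v n * c m n =
      (if u * v ≡ w [MOD q] then (1 : ℝ) else 0) * ∑ m ∈ sM, ∑ n ∈ sN, αu u m * βv v n * Φ (m * n) := by
    intro u v
    rw [mul_sum]
    refine sum_congr rfl fun m _ => ?_
    rw [mul_sum]
    refine sum_congr rfl fun n _ => ?_
    simp only [hαu, hβv, hc]
    by_cases hmu : m % q = u
    · by_cases hnv : n % q = v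
      · have key : (m * n ≡ w [MOD q]) ↔ (u * v ≡ w [MOD q]) := by
          simp only [Nat.ModEq]
          rw [Nat.mul_mod m n q, hmu, hnv]
        rw [if_pos hmu, if_pos hnv]
        by_cases huv : u * v ≡ w [MOD q]
        · rw [if_pos huv, if_pos (key.2 huv)]; ring
        · rw [if_neg huv, if_neg (fun h => huv (key.1 h))]; ring
      · rw [if_neg hnv]; simp
    · rw [if_neg hmu]; simp
  -- Step 3: each class pair by the bilinear bound
  have hbound : ∀ u v, |∑ m ∈ sM, ∑ n ∈ sN, αu u m * βv v n * c m n| ≤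
      C * Real.sqrt (∑ m ∈ sM, αu u m ^ 2) * Real.sqrt (∑ n ∈ sN, βv v n ^ 2) * X := by
    intro u v
    rw [hpair u v, abs_mul]
    have hind : |(if u * v ≡ w [MOD q] then (1 : ℝ) else 0)| ≤ 1 := by split_ifs <;> simp
    have hB := hΦ M N hN hNM (αu u) (βv v)
    calc |(if u * v ≡ w [MOD q] then (1 : ℝ) else 0)| * |∑ m ∈ sM, ∑ n ∈ sN, αu u m * βv v n * Φ (m * n)|
        ≤ 1 * (C * Real.sqrt (∑ m ∈ sM, αu u m ^ 2) * Real.sqrt (∑ n ∈ sN, βv v n ^ 2) * X) :=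
          mul_le_mul hind hB (abs_nonneg _) zero_le_one
      _ = _ := one_mul _
  -- Step 4: sum over the class pairs and Cauchy–Schwarz
  have hαCS := sum_range_sqrt_sum_sq_ite_le hq sM α
  have hβCS := sum_range_sqrt_sum_sq_ite_le hq sN β
  have hsqq : Real.sqrt q * Real.sqrt q = q := Real.mul_self_sqrt (Nat.cast_nonneg q)
  change |∑ m ∈ sM, ∑ n ∈ sN, α m * β n * c m n| ≤
    C * q * Real.sqrt (∑ m ∈ sM, α m ^ 2) * Real.sqrt (∑ n ∈ sN, β n ^ 2) * X
  rw [hexp]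
  calc |∑ u ∈ range q, ∑ v ∈ range q, ∑ m ∈ sM, ∑ n ∈ sN, αu u m * βv v n * c m n|
      ≤ ∑ u ∈ range q, ∑ v ∈ range q, |∑ m ∈ sM, ∑ n ∈ sN, αu u m * βv v n * c m n| :=
        (abs_sum_le_sum_abs _ _).trans (sum_le_sum fun u _ => abs_sum_le_sum_abs _ _)
    _ ≤ ∑ u ∈ range q, ∑ v ∈ range q,
          C * Real.sqrt (∑ m ∈ sM, αu u m ^ 2) * Real.sqrt (∑ n ∈ sN, βv v n ^ 2) * X :=
        sum_le_sum fun u _ => sum_le_sum fun v _ => hbound u v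
    _ = C * X * ((∑ u ∈ range q, Real.sqrt (∑ m ∈ sM, αu u m ^ 2)) *
          (∑ v ∈ range q, Real.sqrt (∑ n ∈ sN, βv v n ^ 2))) := by
        rw [sum_mul_sum, mul_sum]
        refine sum_congr rfl fun u _ => ?_
        rw [mul_sum]
        refine sum_congr rfl fun v _ => ?_
        ring
    _ ≤ C * X * ((Real.sqrt q * Real.sqrt (∑ m ∈ sM, α m ^ 2)) *
          (Real.sqrt q * Real.sqrt (∑ n ∈ sN, β n ^ 2))) := by
        refine mul_le_mul_of_nonneg_left ?_ (mul_nonneg hC hX0)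
        exact mul_le_mul hαCS hβCS (sum_nonneg fun _ _ => Real.sqrt_nonneg _) (by positivity)
    _ = C * (Real.sqrt q * Real.sqrt q) * Real.sqrt (∑ m ∈ sM, α m ^ 2) *
          Real.sqrt (∑ n ∈ sN, β n ^ 2) * X := by ring
    _ = C * q * Real.sqrt (∑ m ∈ sM, α m ^ 2) * Real.sqrt (∑ n ∈ sN, β n ^ 2) * X := by rw [hsqq]

/-- **Class splitting on a dyadic box, either orientation**: for `M, N ≥ 1` (no order assumed),
`|∑_{m∈(M,2M]} ∑_{n∈(N,2N]} α(m) β(n) 1[mn ≡ w (q)] Φ(mn)|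
  ≤ C q ‖α‖₂ ‖β‖₂ (MN)^{1/2} (N^{−1/2} + M^{−η} + M^{−1/2} + N^{−η})`. [folklore] -/
theorem abs_box_le {Φ : ℕ → ℝ} {η C : ℝ} (hC : 0 ≤ C)
    (hΦ : ∀ M N : ℕ, 1 ≤ N → N ≤ M → ∀ α β : ℕ → ℝ,
      |∑ m ∈ Ioc M (2 * M), ∑ n ∈ Ioc N (2 * N), α m * β n * Φ (m * n)| ≤
        C * Real.sqrt (∑ m ∈ Ioc M (2 * M), α m ^ 2) * Real.sqrt (∑ n ∈ Ioc N (2 * N), β n ^ 2) *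
          (Real.sqrt ((M : ℝ) * N) * ((N : ℝ) ^ (-(1 / 2 : ℝ)) + (M : ℝ) ^ (-η))))
    {q : ℕ} (hq : 0 < q) (w : ℕ) {M N : ℕ} (hM : 1 ≤ M) (hN : 1 ≤ N) (α β : ℕ → ℝ) :
    |∑ m ∈ Ioc M (2 * M), ∑ n ∈ Ioc N (2 * N),
        α m * β n * (if m * n ≡ w [MOD q] then Φ (m * n) else 0)| ≤
      C * q * Real.sqrt (∑ m ∈ Ioc M (2 * M), α m ^ 2) * Real.sqrt (∑ n ∈ Ioc N (2 * N), β n ^ 2) *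
        (Real.sqrt ((M : ℝ) * N) * ((N : ℝ) ^ (-(1 / 2 : ℝ)) + (M : ℝ) ^ (-η) +
          ((M : ℝ) ^ (-(1 / 2 : ℝ)) + (N : ℝ) ^ (-η)))) := by
  have hpre : 0 ≤ C * q * Real.sqrt (∑ m ∈ Ioc M (2 * M), α m ^ 2) *
      Real.sqrt (∑ n ∈ Ioc N (2 * N), β n ^ 2) * Real.sqrt ((M : ℝ) * N) := by positivity
  have hA0 : 0 ≤ (N : ℝ) ^ (-(1 / 2 : ℝ)) + (M : ℝ) ^ (-η) := by positivity
  have hB0 : 0 ≤ (M : ℝ) ^ (-(1 / 2 : ℝ)) + (N : ℝ) ^ (-η) := by positivity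
  rcases le_or_gt N M with hNM | hMN
  · -- long variable first
    calc _ ≤ C * q * Real.sqrt (∑ m ∈ Ioc M (2 * M), α m ^ 2) * Real.sqrt (∑ n ∈ Ioc N (2 * N), β n ^ 2) *
          (Real.sqrt ((M : ℝ) * N) * ((N : ℝ) ^ (-(1 / 2 : ℝ)) + (M : ℝ) ^ (-η))) :=
          abs_box_class_le hC hΦ hq w hN hNM α β
      _ ≤ _ := by
          rw [mul_add (Real.sqrt ((M : ℝ) * N))]
          nlinarith [mul_nonneg hpre hB0]
  · -- short variable first: swap the sums and the factors
    have hswap : ∑ m ∈ Ioc M (2 * M), ∑ n ∈ Ioc N (2 * N),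
        α m * β n * (if m * n ≡ w [MOD q] then Φ (m * n) else 0) =
        ∑ n ∈ Ioc N (2 * N), ∑ m ∈ Ioc M (2 * M),
          β n * α m * (if n * m ≡ w [MOD q] then Φ (n * m) else 0) := by
      rw [sum_comm]
      refine sum_congr rfl fun n _ => sum_congr rfl fun m _ => ?_
      rw [mul_comm n m]; ring
    rw [hswap]
    calc _ ≤ C * q * Real.sqrt (∑ n ∈ Ioc N (2 * N), β n ^ 2) * Real.sqrt (∑ m ∈ Ioc M (2 * M), α m ^ 2) *
          (Real.sqrt ((N : ℝ) * M) * ((M : ℝ) ^ (-(1 / 2 : ℝ)) + (N : ℝ) ^ (-η))) :=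
          abs_box_class_le hC hΦ hq w hM hMN.le β α
      _ = C * q * Real.sqrt (∑ m ∈ Ioc M (2 * M), α m ^ 2) * Real.sqrt (∑ n ∈ Ioc N (2 * N), β n ^ 2) *
          (Real.sqrt ((M : ℝ) * N) * ((M : ℝ) ^ (-(1 / 2 : ℝ)) + (N : ℝ) ^ (-η))) := by
          rw [mul_comm (N : ℝ) M]; ring
      _ ≤ _ := by
          rw [mul_add (Real.sqrt ((M : ℝ) * N))]
          nlinarith [mul_nonneg hpre hA0]

end Summit.Parity.GeneralizedHardyLittlewood.Theorems.TypeIIToLevel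

end
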